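import Summits.Ventures.PercRepro.S1DisjointSumThreeSixProfile

/-!
# PercRepro — THE `(3, 6)`-SPLIT CONSUMER AT `(9, 4)`: A COLOOP-FREE SIMPLE RANK-3 PART ON 6 POINTS ⊕ A
COLOOP-FREE SIMPLE RANK-6 PART ON 8 POINTS (p2, gen 28; SUBCLAIM-S1 §6.10 (xvii)(j))

The third non-circuit `1`-separable shape of the `(9, 5)` cell: `M` of rank `3` on `6` points (corank `3`) and `N`
of rank `6` on `8` points (corank `2`), both coloop-free with every pair of distinct points of rank `2`. Then
`#U(M ⊕ N; 9, 4) ≤ 25 N_N(6, 2) + 160` (`N_M(3, 2) ≤ 15 + 10`, `N_M(3, 3) ≤ 20`, `N_N(6, 1) ≤ 8`) and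
`#Y(M ⊕ N; 9, 4) ≥ 842 + 38 (f_N(3) + f_N(4) + f_N(5))` (`f_M(3) ≥ 23`, `f_M(2) ≥ 15`, `f_M(1) ≥ 6`, `f_N(2) ≥ 28`,
`f_N(6) ≥ 9`); Theorem N at `(6, 2)` on `N` (`Φ = 13/2`) bounds `N_N(6, 2) ≤ (2/13)(f_N(3) + f_N(4) + f_N(5))`, and
`f_N(3) + f_N(4) + f_N(5) ≥ 126` closes: `Φ(9, 4) · #U ≤ 1344 + 32.31 S ≤ 842 + 38 S`. Nothing is claimed about any cell.

* `ncard_U_disjointSum_three_six_le`, `ncard_Y_disjointSum_three_six_ge`, `consumer_arith_three_six`;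
* **`c025_nine_four_disjointSum_three_six`** — the consumer.
Axioms: standard.
-/

open scoped Matroid

namespace PercRepro

namespace S1

open Set

variable {α : Type}

/-- **The `U`-side of the `(3, 6)` split**: `#U(M ⊕ N; 9, 4) ≤ 25 N_N(6, 2) + 160`. -/
theorem ncard_U_disjointSum_three_six_le (M N : Matroid α) [M.Finite] [N.Finite] (h : Disjoint M.E N.E)
    (hM : M.eRank = ((3 : ℕ) : ℕ∞)) (hME : M.E.ncard = 6) (hcolM : M.coloops = ∅)
    (hpairsM : ∀ e ∈ M.E, ∀ f ∈ M.E, e ≠ f → M.eRk {e, f} = 2) (hN : N.eRank = ((6 : ℕ) : ℕ∞))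
    (hNE : N.E.ncard = 8) (hpairsN : ∀ e ∈ N.E, ∀ f ∈ N.E, e ≠ f → N.eRk {e, f} = 2) :
    {A : Set α | A ⊆ (M.disjointSum N h).E ∧ (M.disjointSum N h).eRk A = ((9 : ℕ) : ℕ∞) ∧
        (M.disjointSum N h).eRk ((M.disjointSum N h).E \ A) = ((4 : ℕ) : ℕ∞)}.ncard ≤
      25 * (profileSet N 6 2).ncard + 160 := by
  rw [disjointSum_ncard_U_eq_finsum M N h 9 4, finsum_mem_coe_finset]
  rw [Finset.sum_eq_add_of_mem (3, 2) (3, 3) (by decide) (by decide) (by decide) ?_]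
  · dsimp only
    rw [show (9 : ℕ) - 3 = 6 from rfl, show (4 : ℕ) - 2 = 2 from rfl, show (4 : ℕ) - 3 = 1 from rfl]
    have hT := three_mul_ncard_rankTwoTriples_le hM hcolM hpairsM hME
    have h32 := ncard_profileSet_three_two_le_add (M := M) hME
    have h32' : (profileSet M 3 2).ncard ≤ 25 := by omega
    have h33 := ncard_profileSet_le_choose_of_ncard_eq (N := M) (a := 3) (b := 3) hME
    rw [show Nat.choose (3 + 3) 3 = 20 by decide] at h33
    have h61 := ncard_profileSet_top_one_le_of_pairs' hpairsN 6
    rw [hNE] at h61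
    calc (profileSet M 3 2).ncard * (profileSet N 6 2).ncard + (profileSet M 3 3).ncard * (profileSet N 6 1).ncard
        ≤ 25 * (profileSet N 6 2).ncard + 20 * 8 :=
          Nat.add_le_add (Nat.mul_le_mul_right _ h32') (Nat.mul_le_mul h33 h61)
      _ = 25 * (profileSet N 6 2).ncard + 160 := by ring
  · rintro ⟨a, b⟩ hmem ⟨hne1, hne2⟩
    rw [Finset.mem_product, Finset.mem_range, Finset.mem_range] at hmem
    dsimp only
    rcases Nat.lt_or_ge 3 a with ha | ha
    · rw [profileSet_eq_empty_of_eRank_lt M hM ha b, ncard_empty, zero_mul]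
    rcases Nat.lt_or_ge a 3 with ha' | ha'
    · have h9a : 6 < 9 - a := by omega
      rw [profileSet_eq_empty_of_eRank_lt N hN h9a (4 - b), ncard_empty, mul_zero]
    have ha3 : a = 3 := by omega
    subst ha3
    rw [show (9 : ℕ) - 3 = 6 from rfl]
    rcases Nat.lt_or_ge b 2 with hb | hb
    · -- `b ≤ 1`: the `N`-complement would need `≥ 3` points beside a spanning set of `≥ 6` points
      have h8 : N.E.ncard < 6 + (4 - b) := by rw [hNE]; omega
      rw [profileSet_eq_empty_of_ncard_lt N h8, ncard_empty, mul_zero]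
    · have hb4 : b = 4 := by
        rcases Nat.lt_or_ge b 4 with hb4 | hb4
        · exfalso
          rcases Nat.lt_or_ge b 3 with hb3 | hb3
          · exact hne1 (by congr 1; omega)
          · exact hne2 (by congr 1; omega)
        · omega
      subst hb4
      -- `N_M(3, 4) = ∅`: a complement of rank `4` in a matroid of rank `3`
      rw [profileSet_eq_empty_of_eRank_lt_snd M hM (by norm_num) 3, ncard_empty, zero_mul]

/-- **The `Y`-side of the `(3, 6)` split**: `#Y(M ⊕ N; 9, 4) ≥ 842 + 38 (f_N(3) + f_N(4) + f_N(5))`. -/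
theorem ncard_Y_disjointSum_three_six_ge (M N : Matroid α) [M.Finite] [N.Finite] (h : Disjoint M.E N.E)
    (hM : M.eRank = ((3 : ℕ) : ℕ∞)) (hME : M.E.ncard = 6) (hcolM : M.coloops = ∅)
    (hpairsM : ∀ e ∈ M.E, ∀ f ∈ M.E, e ≠ f → M.eRk {e, f} = 2) (hN : N.eRank = ((6 : ℕ) : ℕ∞))
    (hNE : N.E.ncard = 8) (hcolN : N.coloops = ∅) (hpairsN : ∀ e ∈ N.E, ∀ f ∈ N.E, e ≠ f → N.eRk {e, f} = 2) :
    842 + 38 * ((rankSet N 3).ncard + (rankSet N 4).ncard + (rankSet N 5).ncard) ≤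
      {A : Set α | A ⊆ (M.disjointSum N h).E ∧ ((4 : ℕ) : ℕ∞) < (M.disjointSum N h).eRk A ∧
        (M.disjointSum N h).eRk A < ((9 : ℕ) : ℕ∞)}.ncard := by
  rw [disjointSum_ncard_Y_eq_finsum M N h 9 4, finsum_mem_coe_finset]
  have hsub : ({(3, 2), (3, 3), (3, 4), (3, 5), (2, 3), (2, 4), (2, 5), (2, 6), (1, 4), (1, 5), (1, 6), (0, 5),
      (0, 6)} : Finset (ℕ × ℕ)) ⊆
      (Finset.range 9 ×ˢ Finset.range 9).filter (fun x : ℕ × ℕ => 4 < x.1 + x.2 ∧ x.1 + x.2 < 9) := by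
    decide
  refine le_trans ?_ (Finset.sum_le_sum_of_subset hsub)
  rw [Finset.sum_insert (by decide), Finset.sum_insert (by decide), Finset.sum_insert (by decide),
    Finset.sum_insert (by decide), Finset.sum_insert (by decide), Finset.sum_insert (by decide),
    Finset.sum_insert (by decide), Finset.sum_insert (by decide), Finset.sum_insert (by decide),
    Finset.sum_insert (by decide), Finset.sum_insert (by decide), Finset.sum_insert (by decide),
    Finset.sum_singleton]
  dsimp only
  have F3 := ncard_rankSet_three_ge_of_pairs hM hcolM hpairsM hME
  have F2 : 15 ≤ (rankSet M 2).ncard := by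
    have := choose_le_ncard_rankSet_two_of_pairs hpairsM
    rwa [hME, show Nat.choose 6 2 = 15 by decide] at this
  have F1 : 6 ≤ (rankSet M 1).ncard := by
    have := ncard_le_ncard_rankSet_one_of_pairs hpairsM (by omega)
    rwa [hME] at this
  have F0 : 1 ≤ (rankSet M 0).ncard := by
    have h0 : (∅ : Set α) ∈ rankSet M 0 := ⟨empty_subset _, by rw [M.eRk_empty]; rfl⟩
    exact (ncard_pos (rankSet_finite M 0)).mpr ⟨∅, h0⟩
  have G2 : 28 ≤ (rankSet N 2).ncard := by
    have := choose_le_ncard_rankSet_two_of_pairs hpairsN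
    rwa [hNE, show Nat.choose 8 2 = 28 by decide] at this
  have G6 := nine_le_ncard_rankSet_six hN hNE hcolN
  have e32 := Nat.mul_le_mul F3 G2
  have e33 := Nat.mul_le_mul_right (rankSet N 3).ncard F3
  have e34 := Nat.mul_le_mul_right (rankSet N 4).ncard F3
  have e35 := Nat.mul_le_mul_right (rankSet N 5).ncard F3
  have e23 := Nat.mul_le_mul_right (rankSet N 3).ncard F2
  have e24 := Nat.mul_le_mul_right (rankSet N 4).ncard F2
  have e25 := Nat.mul_le_mul_right (rankSet N 5).ncard F2
  have e26 := Nat.mul_le_mul F2 G6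
  have e16 := Nat.mul_le_mul F1 G6
  have e06 := Nat.mul_le_mul F0 G6
  have n14 : 0 ≤ (rankSet M 1).ncard * (rankSet N 4).ncard := Nat.zero_le _
  have n15 : 0 ≤ (rankSet M 1).ncard * (rankSet N 5).ncard := Nat.zero_le _
  have n05 : 0 ≤ (rankSet M 0).ncard * (rankSet N 5).ncard := Nat.zero_le _
  linarith

/-- The arithmetic of the `(3, 6)`-split consumer: `u ≤ 25 P₂ + 160`, `(13/2) P₂ ≤ S`, `y ≥ 842 + 38 S`,
`S ≥ 126` give `(42/5) u ≤ y`. -/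
theorem consumer_arith_three_six {u y P2 S : ℚ} (hU : u ≤ 25 * P2 + 160) (h62 : 13 / 2 * P2 ≤ S)
    (hY : 842 + 38 * S ≤ y) (hS : 126 ≤ S) : 42 / 5 * u ≤ y := by
  linarith

/-- **THE `(3, 6)`-SPLIT CONSUMER**: `Φ(9, 4) · #U(M ⊕ N; 9, 4) ≤ #Y(M ⊕ N; 9, 4)` for every finite coloop-free
`M` of rank `3` on `6` points and every finite coloop-free `N` of rank `6` on `8` points, both with all pairs of
distinct points of rank `2` — from Theorem N at `(6, 2)` on `N`, the two profiles and the double count on `M`. -/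
theorem c025_nine_four_disjointSum_three_six (M N : Matroid α) [M.Finite] [N.Finite]
    (h : Disjoint M.E N.E) (hM : M.eRank = ((3 : ℕ) : ℕ∞)) (hME : M.E.ncard = 6) (hcolM : M.coloops = ∅)
    (hpairsM : ∀ e ∈ M.E, ∀ f ∈ M.E, e ≠ f → M.eRk {e, f} = 2) (hN : N.eRank = ((6 : ℕ) : ℕ∞))
    (hNE : N.E.ncard = 8) (hcolN : N.coloops = ∅) (hpairsN : ∀ e ∈ N.E, ∀ f ∈ N.E, e ≠ f → N.eRk {e, f} = 2) :
    phiK 9 4 * ({A : Set α | A ⊆ (M.disjointSum N h).E ∧ (M.disjointSum N h).eRk A = ((9 : ℕ) : ℕ∞) ∧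
        (M.disjointSum N h).eRk ((M.disjointSum N h).E \ A) = ((4 : ℕ) : ℕ∞)}.ncard : ℚ) ≤
      ({A : Set α | A ⊆ (M.disjointSum N h).E ∧ ((4 : ℕ) : ℕ∞) < (M.disjointSum N h).eRk A ∧
        (M.disjointSum N h).eRk A < ((9 : ℕ) : ℕ∞)}.ncard : ℚ) := by
  have hU := ncard_U_disjointSum_three_six_le M N h hM hME hcolM hpairsM hN hNE hpairsN
  have hY := ncard_Y_disjointSum_three_six_ge M N h hM hME hcolM hpairsM hN hNE hcolN hpairsN
  have hS := ncard_rankSet_sum_ge_three_five hN hNE hcolN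
  have h62 : (13 / 2 : ℚ) * ((profileSet N 6 2).ncard : ℚ) ≤
      ((rankSet N 3).ncard : ℚ) + ((rankSet N 4).ncard : ℚ) + ((rankSet N 5).ncard : ℚ) := by
    have h0 := ThmN.c025_two_all N 6 (by norm_num)
    unfold ThmN.RLS at h0
    rw [phiK_six_two,
      ySet_eq_rankSet_union3_of_eq N (q := 2) (p := 6) (k := 3) (k' := 4) (k'' := 5) rfl rfl rfl rfl,
      ncard_union_eq (Set.disjoint_union_left.mpr
        ⟨rankSet_disjoint_of_ne N (by norm_num), rankSet_disjoint_of_ne N (by norm_num)⟩)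
        ((rankSet_finite N 3).union (rankSet_finite N 4)) (rankSet_finite N 5),
      ncard_union_eq (rankSet_disjoint_of_ne N (by norm_num)) (rankSet_finite N 3) (rankSet_finite N 4)] at h0
    push_cast at h0
    exact h0
  rw [phiK_nine_four]
  have hU' : (({A : Set α | A ⊆ (M.disjointSum N h).E ∧ (M.disjointSum N h).eRk A = ((9 : ℕ) : ℕ∞) ∧
      (M.disjointSum N h).eRk ((M.disjointSum N h).E \ A) = ((4 : ℕ) : ℕ∞)}.ncard : ℕ) : ℚ) ≤
      25 * ((profileSet N 6 2).ncard : ℚ) + 160 := by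
    exact_mod_cast hU
  have hY' : 842 + 38 * (((rankSet N 3).ncard : ℚ) + ((rankSet N 4).ncard : ℚ) + ((rankSet N 5).ncard : ℚ)) ≤
      (({A : Set α | A ⊆ (M.disjointSum N h).E ∧ ((4 : ℕ) : ℕ∞) < (M.disjointSum N h).eRk A ∧
        (M.disjointSum N h).eRk A < ((9 : ℕ) : ℕ∞)}.ncard : ℕ) : ℚ) := by
    exact_mod_cast hY
  have hS' : (126 : ℚ) ≤ ((rankSet N 3).ncard : ℚ) + ((rankSet N 4).ncard : ℚ) + ((rankSet N 5).ncard : ℚ) := by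
    exact_mod_cast hS
  exact consumer_arith_three_six hU' h62 hY' hS'

end S1

end PercRepro
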